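import Literature.MathematicalPhysics.QuantumFieldTheory.Balaban1983to89.Beta.AveragingContours

/-!
# `Balaban1983to89.Beta.AxialProjector` — the axial (block-tree) projector `Π := 1 − d∘G_tree∘τ_tree` of route (α) (RULING (R29)):
# the projector onto the tree slice along the residual (evaluation-type) gauge orbits, its kernel facts, its locality, the
# `U = 1` dictionary identity «Bałaban's centre-to-centre linear average = the straight-contour average of the Π-dressed field»,
# and (v1.1) its TRANSPOSE `Πᵀ` on covariant bond families with the adjunction `⟨Πᵀg, A⟩ = ⟨g, ΠA⟩` and sup bounds

HONEST FRAMING (cell `pub-balaban`, β-function road; verbatim): «discharging BetaPertH makes Balaban's UV stability UNCONDITIONAL —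
a real constructive-QFT result; it is NOT the continuum limit and NOT the Clay problem.»  ABSOLUTE RULE (verbatim): «No
internally-minted statement may enter as a cited fact. Every hypothesis is either kernel-proved in this package or a verbatim
quotation of a PUBLISHED theorem with page reference. The manuscript(s) under audit are NOT citable for their own disputed steps —
they are the thing under adjudication; programme-internal (2001/route/tribunal) claims are never citable.»  This file cites NOTHING:
every declaration is a definition or a kernel-checked lemma about definitions ([folklore] tags throughout); no `Prop` mirrors a
printed claim (the predicates `BlockConst`, `InPath`, `BlockClosed` are definitions); it carries no quotation of its own — the printed sentences it is
the combinatorial layer of are quoted VERBATIM, with page references, in the headers of `Beta.AveragingContours` ([Balaban1984PropagatorsI]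
p.19 (1.10), the axial gauge fixing conditions `A(Γ_{y,x}) = 0` inside the blocks) and `Beta.GaugeFixing` ([Balaban1987RG1]
p.254, the block axial gauge «as in [9, 16]» of the renormalization transformation, as opposed to the exponential gauge fixing (0.14)
of that page), and are used here as LOCATORS only (v1.1: key and description of this locator corrected after XREAD an4-g19, C-an4-42).

WHAT THIS IS.  RULING (R29) of the β-lead (journal 2026-08-19T16:05:08Z; `SLICE-FP-NOTE.md` v0.3): the typed one-loop families
`OneStepKernelFamily.TbalOf`/`TshotOf` are Hessians of the effective action of the SHARP, `B`-independent WEAK-LANDAU slice of the typed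
KKT system WITHOUT that slice's Faddeev–Popov quotient, whereas the printed one-loop kernel is the Hessian of the ORBIT functional; the
two agree exactly for a slice that is UNIPOTENT on the residual gauge algebra `𝔫_ev` (gauge functions vanishing at the block base
points), and the block-TREE (axial) slice is unipotent (`Beta.GaugeFixing` §5, `Beta.TreeSliceUnipotent`).  Route (α) (an2's choice,
journal NOTE 16:04Z; RULING (R29-4)/(R29-5)): keep the typed resolvent and DRESS the jets by the block-local finite-range projector
`Π := 1 − d∘G_tree∘τ_tree`, so that the completed object is again `TbalOf Lc J` for jet data `J` of the SAME type.  THIS LEAF TYPES `Π`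
— EXIT-B item (i′-G), first part — on fine one-forms `A : Form1 d R` (`R` any additive commutative group: colour components), over
an1's axial-contour toolkit `Beta.AveragingContours` (node 5), whose `treeGauge A L x = A(Γ_{y(x),x})` (the integral of `A` along
Bałaban's axial contour from the base point `y(x) = L • blk L x` of the block of `x`) IS `G_tree∘τ_tree`, and whose attainability
theorem `axialGauge_treeGauge` IS `τ_tree∘Π = 0`:

    `axProj L A := A − grad (treeGauge A L)`.

CONTENT (all `d`, all `L`; `1 ≤ L` where the block decomposition is used).
* §1 `axProj` and its range: `axialGauge_axProj` (the dressed field is axial: `τ_tree∘Π = 0`); `treeGauge_base` (the tree integral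
  vanishes at base points); `treeGauge_eq_zero_of_axialGauge`, `axProj_eq_self_of_axialGauge`, `axProj_idem` (`Π∘Π = Π`),
  `axialGauge_iff_axProj_eq` (range `Π` = the tree slice).
* §2 `Π` on exact forms: `treeGauge_grad` (`G_tree τ_tree (df) = f − f∘base`), `axProj_grad : Π (grad f) = grad (f ∘ base)`;
  hence `axProj_grad_eq_zero` — `Π` KILLS THE RESIDUAL (evaluation-type) GAUGE MODES `d𝔫_ev` (`f` vanishing at the base points
  `L•y`) — and `axProj_grad_of_blockConst` — COARSE pure gauges (`f` block-constant) pass through `Π` unchanged; and the kernel: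
  `axProj_eq_zero_iff : Π A = 0 ↔ ∃ f, (∀ y, f (L•y) = 0) ∧ A = grad f` (`ker Π = d𝔫_ev`).  With §1: `Π` is THE projector onto the
  tree slice along the `𝔫_ev`-orbits — the linear-algebra content of «`1 − d∘G_tree∘τ_tree`».
* §3 linearity: a letter-level transport lemma `axial_map` for additive homomorphisms (so `treeGauge_map`, `axProj_map`), whence
  `axProj_zero/add/neg/sub` and, over a commutative ring, `axProj_smul`.
* §4 coarse-translation covariance: `blk_add_zsmul`, `treeGauge_shift`, `axProj_shift` (`Π` commutes with translations by `L•v`).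
* §5 LOCALITY (finite range): `treeGauge_congr` — `treeGauge A L x` depends on `A` only through the bonds of the block of `x` — and
  `axProj_congr_local` — `Π A κ x` depends on `A` only through the blocks of `x` and of `x + e_κ`; this is what keeps `LocStencil` /
  `VertexFamily₂` under the dressing (the (A2) functor, not here).
* §6 THE `U = 1` DICTIONARY HALF of (R29-4)'s CHECK ITEM (residual group / «both points of view»): `linAvg_axProj : linAvg (Π A) =
  linAvg A` (Bałaban's centre-to-centre linear average [Balaban1985Averaging] (14), an1's `linAvg`, is BLIND to the tree dressing —
  `linAvg_gauge` with a gauge function vanishing at the base points) and **`linAvg_eq_contourSum_axProj : linAvg A L μ y =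
  contourSum L (axProj L A) μ y`** — on EVERY field Bałaban's linear average equals an2's straight-contour average
  (`AffineAveraging.contourSum`, the base row of the typed KKT system) OF THE Π-DRESSED FIELD («Q_Bal = Q_typed ∘ Π_ax» at `U = 1`;
  an1's `linAvg_eq_contourSum_of_axialGauge` composed with §1).
* §7 three sanity instances on `ℤ²`, `L = 2`.
* §8 (v1.1) THE TREE INTEGRAL AS A COMB SUM: `segUp_sum'`, `sub_base_eq_off`, `axialAux_base_sum`, **`treeGauge_eq_sum_comb`**:
  `treeGauge A L p = Σ_α Σ_{s < off p α} A_α(corner(y,p,α+1) + s·e_α)`; the comb offsets `combVec` (`base_add_combVec`,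
  `combVec_mem_box`, `combVec_injective`).
* §9 (v1.1) THE TRANSPOSE `Πᵀ` (`coProj`) on covariant bond families — the operation that DRESSES a kernel LEG of a jet / the bond
  slot of a stencil (route (α): `TbalOf Lc (dress J)` keeps the resolvent `KInv` and moves the slice change onto the jets):
  `cod` (`dᵀ`, the bond-to-point codifferential), `InPath` (decidable path membership `(α,q) ∈ Γ_{y,p}`), `subtreeSum` (`G_treeᵀ`),
  `coProj L g := g − subtreeSum L (cod g)` (`Πᵀ = 1 − G_treeᵀ∘dᵀ` on tree bonds); `coProj_zero/add/sub`; LOCALITY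
  **`coProj_congr_local`** (`(Πᵀg)_α(q)` reads `g` only on the block of `q` and its incoming boundary bonds), `coProj_eq_zero_of_local`.
* §10 (v1.1) `inPath_iff` (path membership = comb parametrisation), `sum_inPath_eq_sum_comb`, **`treeGauge_eq_sum_inPath`** — the
  matrix of `G_tree∘τ_tree` as the path indicator.
* §11 (v1.1) THE ADJUNCTION: `BlockClosed`, `image_box_eq_filter`, `sum_block_swap` (block double-sum swap), `sum_mul_grad_eq`
  (summation by parts, `grad` against `cod`), and **`sum_coProj_mul : Σ_{x∈U} Σ_α (Πᵀg)_α(x)·A_α(x) = Σ_{x∈U} Σ_α g_α(x)·(ΠA)_α(x)`**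
  for a block-closed finite `U` containing the support and the heads of `g`, and ANY `A` — the identity `tr(K·ΠᵀW) = tr(ΠK·W)`
  leg by leg, i.e. the algebraic content of the dressing lemma: dressing covariant jets by `Πᵀ` ≡ dressing the contravariant
  resolvent / minimiser columns (`Γ_tree = Π Γ Πᵀ`, `ℋ_tree = Π ℋ`; `GaugeFixingPropagators.kktInv_sliceChange`) by `Π`.
* §12 (v1.1) SUP BOUNDS (real forms): `abs_treeGauge_le` (`≤ d·L·M`), **`abs_axProj_le`** (`≤ (1+2dL)·M`), `abs_cod_le`,
  **`abs_coProj_le`** (`≤ (1+2d·L^d)·M`) — `Π`, `Πᵀ` are bounded operators of range one block, so exponential localisation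
  (`LocStencil`, `VertexFamily₂`, `Decays`) survives the dressing with an explicit `L`-dependent constant.

WHAT IS NOT HERE.  (a) The `B`-dependent statement — unipotency `|det(τ_tree·D_B)↾𝔫_ev| = 1` — is `Beta.TreeSliceUnipotent` (co-lead)
over `Beta.GaugeFixing` (pv25); this leaf is the `U = 1` projector only.  (b) The DRESSING FUNCTOR on `MKer`-legs / `JetData` itself (bond
slot and both kernel legs through `Πᵀ` = `coProj` of §9, leg by leg) with the `LocStencil`/`VertexFamily₂` bookkeeping from §12, and
the `tsum` form of §11's adjunction against the ℓ¹ resolvent — item (A2), next, over this leaf.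
(c) Hierarchical trees (`Π_{Lc^{m+1}}` versus `Π_{Lc^m}`) — item (A4).  (d) Bałaban roots `Γ_{y,x}` at the block's label point `y`;
here, as in `AveragingContours.treeGauge`, the root is the base point `L • blk L x` — a fixed in-block relabelling, immaterial for every
statement of this file.  (e) No claim of [B5]/[B7]/[B12] is asserted; NOT continuum; NOT Clay.

Provenance: b2b-balaban β sub-cell, unit beta-an2 gen 9 (node AXPROJ, EXIT-B (i′-G) route (α)), 2026-08-19; v1 `9320078ec86e`,
v1.1 (§8–§12) same day.  Bib keys (locators only):
Balaban1984PropagatorsI, Balaban1985Averaging, Balaban1987RG1.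
-/

namespace Literature.MathematicalPhysics.QuantumFieldTheory.Balaban1983to89.Beta.AxialProjector

open Finset
open Literature.MathematicalPhysics.QuantumFieldTheory.Balaban1983to89.Beta.AffineAveraging
open Literature.MathematicalPhysics.QuantumFieldTheory.Balaban1983to89.Beta.AveragingContours

/-! ## §1 The projector and its range (the tree slice) -/

section Basic

variable {d : ℕ} {R : Type*} [AddCommGroup R]

/-- [folklore] **THE AXIAL (BLOCK-TREE) PROJECTOR** `Π A := A − grad (treeGauge A L)` = `(1 − d∘G_tree∘τ_tree) A`: subtract the
gradient of the integral of `A` along the axial contour from the base point of each block. -/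
def axProj (L : ℕ) (A : Form1 d R) : Form1 d R := A - grad (treeGauge A L)

/-- [folklore] Pointwise form of `Π`. -/
theorem axProj_apply (L : ℕ) (A : Form1 d R) (κ : Fin d) (x : Site d) :
    axProj L A κ x = A κ x - (treeGauge A L (x + unitVec κ) - treeGauge A L x) := rfl

/-- [folklore] **`τ_tree ∘ Π = 0`:** the dressed field is in the axial gauge (an1's attainability theorem, by name). -/
theorem axialGauge_axProj (L : ℕ) (A : Form1 d R) : AxialGauge (axProj L A) L := axialGauge_treeGauge A L

/-- [folklore] The block index of a base point `L•y` is `y` (`1 ≤ L`). -/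
theorem blk_zsmul {L : ℕ} (hL : 1 ≤ L) (y : Site d) : blk L ((L : ℤ) • y) = y := by
  have hb0 : (fun _ => (0 : ℕ)) ∈ box d L := by
    simp only [AffineAveraging.box, Fintype.mem_piFinset, Finset.mem_range]
    intro i; omega
  have h := blk_block (L := L) y hb0
  rwa [toSite_zero, add_zero] at h

/-- [folklore] The tree integral vanishes at the base points: `G_tree τ_tree A (L•y) = A(Γ_{L•y, L•y}) = 0`. -/
theorem treeGauge_base {L : ℕ} (hL : 1 ≤ L) (A : Form1 d R) (y : Site d) : treeGauge A L ((L : ℤ) • y) = 0 := by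
  rw [treeGauge, blk_zsmul hL, axial_self, List.sum_nil]

/-- [folklore] On an axial-gauge field the tree integral vanishes identically. -/
theorem treeGauge_eq_zero_of_axialGauge {L : ℕ} (hL : 1 ≤ L) {A : Form1 d R} (hA : AxialGauge A L) (x : Site d) :
    treeGauge A L x = 0 := by
  have h := hA (blk L x) (off L x) (off_mem_box hL x)
  rwa [blk_add_off hL x] at h

/-- [folklore] **`Π` IS THE IDENTITY ON THE SLICE:** an axial-gauge field is its own dressing. -/
theorem axProj_eq_self_of_axialGauge {L : ℕ} (hL : 1 ≤ L) {A : Form1 d R} (hA : AxialGauge A L) : axProj L A = A := by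
  funext κ x
  rw [axProj_apply, treeGauge_eq_zero_of_axialGauge hL hA, treeGauge_eq_zero_of_axialGauge hL hA, sub_zero, sub_zero]

/-- [folklore] **`Π ∘ Π = Π`.** -/
theorem axProj_idem {L : ℕ} (hL : 1 ≤ L) (A : Form1 d R) : axProj L (axProj L A) = axProj L A :=
  axProj_eq_self_of_axialGauge hL (axialGauge_axProj L A)

/-- [folklore] **RANGE OF `Π` = THE TREE SLICE:** `A` is axial iff `Π A = A`. -/
theorem axialGauge_iff_axProj_eq {L : ℕ} (hL : 1 ≤ L) (A : Form1 d R) : AxialGauge A L ↔ axProj L A = A := by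
  constructor
  · exact axProj_eq_self_of_axialGauge hL
  · intro h; rw [← h]; exact axialGauge_axProj L A

end Basic

/-! ## §2 `Π` on exact forms: the residual gauge modes are killed, the coarse ones pass -/

section Exact

variable {d : ℕ} {R : Type*} [AddCommGroup R]

/-- [folklore] `G_tree τ_tree (grad f) (x) = f(x) − f(base of x)` (telescoping along `Γ`). -/
theorem treeGauge_grad (L : ℕ) (f : Site d → R) (x : Site d) :
    treeGauge (grad f) L x = f x - f ((L : ℤ) • blk L x) := axial_sum_grad f _ x

/-- [folklore] `grad` is additive: differences. -/
theorem grad_sub (f g : Site d → R) : grad (f - g) = grad f - grad g := by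
  funext κ x; simp only [grad, Pi.sub_apply]; abel

/-- [folklore] `grad 0 = 0`. -/
theorem grad_zero : grad (0 : Site d → R) = 0 := by
  funext κ x; simp only [grad, Pi.zero_apply, sub_zero]

/-- [folklore] `grad` is additive: sums. -/
theorem grad_add (f g : Site d → R) : grad (f + g) = grad f + grad g := by
  funext κ x; simp only [grad, Pi.add_apply]; abel

/-- [folklore] `grad` is additive: negation. -/
theorem grad_neg (f : Site d → R) : grad (-f) = -grad f := by
  funext κ x; simp only [grad, Pi.neg_apply]; abel

/-- [folklore] The block index of `x + e_κ` read through the base map: `Π (grad f) = grad (f ∘ base)` — the dressing of an exact form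
is the exact form of the restriction of its potential to the base points, extended block-constantly. -/
theorem axProj_grad (L : ℕ) (f : Site d → R) :
    axProj L (grad f) = grad (fun x => f ((L : ℤ) • blk L x)) := by
  funext κ x
  rw [axProj_apply, treeGauge_grad, treeGauge_grad]
  simp only [grad]
  abel

/-- [folklore] **`Π` KILLS THE RESIDUAL GAUGE MODES `d𝔫_ev`:** if the gauge function vanishes at every base point `L•y` (the
linearised residual group `{u : u(y) = 1}` of the tree gauge), then `Π (grad f) = 0`. -/
theorem axProj_grad_eq_zero (L : ℕ) {f : Site d → R} (hf : ∀ y : Site d, f ((L : ℤ) • y) = 0) : axProj L (grad f) = 0 := by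
  rw [axProj_grad]
  funext κ x
  simp only [grad, hf, sub_zero, Pi.zero_apply]

/-- [folklore] A function is BLOCK-CONSTANT if it agrees with its value at the base point of the block. -/
def BlockConst (L : ℕ) (f : Site d → R) : Prop := ∀ x : Site d, f x = f ((L : ℤ) • blk L x)

/-- [folklore] **COARSE PURE GAUGES PASS THROUGH `Π`:** for block-constant `f`, `Π (grad f) = grad f`. -/
theorem axProj_grad_of_blockConst (L : ℕ) {f : Site d → R} (hf : BlockConst L f) : axProj L (grad f) = grad f := by
  rw [axProj_grad]
  funext κ x
  simp only [grad]
  rw [← hf (x + unitVec κ), ← hf x]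

/-- [folklore] **THE KERNEL OF `Π` IS `d𝔫_ev`:** `Π A = 0` iff `A` is the gradient of a function vanishing at the base points
(namely of its own tree integral). -/
theorem axProj_eq_zero_iff {L : ℕ} (hL : 1 ≤ L) (A : Form1 d R) :
    axProj L A = 0 ↔ ∃ f : Site d → R, (∀ y : Site d, f ((L : ℤ) • y) = 0) ∧ A = grad f := by
  constructor
  · intro h
    refine ⟨treeGauge A L, treeGauge_base hL A, ?_⟩
    have h' : A - grad (treeGauge A L) = 0 := h
    exact sub_eq_zero.mp h'
  · rintro ⟨f, hf, rfl⟩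
    exact axProj_grad_eq_zero L hf

end Exact

/-! ## §3 Linearity (letter-level transport along additive homomorphisms) -/

section Map

variable {d : ℕ} {R R' : Type*} [AddCommGroup R] [AddCommGroup R'] (φ : R →+ R')

/-- [folklore] Straight segments transport letterwise. -/
theorem segUp_map (A : Form1 d R) (z : Site d) (κ : Fin d) (n : ℕ) :
    segUp (fun κ x => φ (A κ x)) z κ n = (segUp A z κ n).map φ := by
  simp only [segUp, List.map_map]
  rfl

/-- [folklore] Backward straight segments transport letterwise. -/
theorem segDown_map (A : Form1 d R) (z : Site d) (κ : Fin d) (n : ℕ) :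
    segDown (fun κ x => φ (A κ x)) z κ n = (segDown A z κ n).map φ := by
  simp only [segDown, List.map_map]
  congr 1
  funext s
  simp only [Function.comp_apply, map_neg]

/-- [folklore] Signed straight segments transport letterwise. -/
theorem seg_map (A : Form1 d R) (z : Site d) (κ : Fin d) (n : ℤ) :
    seg (fun κ x => φ (A κ x)) z κ n = (seg A z κ n).map φ := by
  by_cases h : 0 ≤ n
  · simp only [seg, h, if_true, segUp_map]
  · simp only [seg, h, if_false, segDown_map]

/-- [folklore] Partial axial contours transport letterwise. -/
theorem axialAux_map (A : Form1 d R) (y x : Site d) :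
    ∀ m, axialAux (fun κ x => φ (A κ x)) y x m = (axialAux A y x m).map φ
  | 0 => rfl
  | m + 1 => by
    by_cases hm : m < d
    · simp only [axialAux, dif_pos hm, List.map_append, axialAux_map A y x m, seg_map]
    · simp only [axialAux, dif_neg hm, List.map_append, axialAux_map A y x m, List.map_nil]

/-- [folklore] **The axial contour transports letterwise** along any additive homomorphism of the coefficients. -/
theorem axial_map (A : Form1 d R) (y x : Site d) : axial (fun κ x => φ (A κ x)) y x = (axial A y x).map φ :=
  axialAux_map φ A y x d

/-- [folklore] The tree integral commutes with additive homomorphisms of the coefficients. -/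
theorem treeGauge_map (A : Form1 d R) (L : ℕ) (x : Site d) :
    treeGauge (fun κ x => φ (A κ x)) L x = φ (treeGauge A L x) := by
  rw [treeGauge, treeGauge, axial_map, map_list_sum]

/-- [folklore] `Π` commutes with additive homomorphisms of the coefficients. -/
theorem axProj_map (A : Form1 d R) (L : ℕ) (κ : Fin d) (x : Site d) :
    axProj L (fun κ x => φ (A κ x)) κ x = φ (axProj L A κ x) := by
  rw [axProj_apply, axProj_apply, treeGauge_map, treeGauge_map, map_sub, map_sub]

end Map

section Linear

variable {d : ℕ} {R : Type*} [AddCommGroup R]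

/-- [folklore] The tree integral of a difference. -/
theorem treeGauge_sub (A A' : Form1 d R) (L : ℕ) (x : Site d) :
    treeGauge (A - A') L x = treeGauge A L x - treeGauge A' L x := axial_sum_sub A A' _ x

/-- [folklore] The tree integral of `0`. -/
theorem treeGauge_zero (L : ℕ) (x : Site d) : treeGauge (0 : Form1 d R) L x = 0 := by
  have h := treeGauge_sub (0 : Form1 d R) 0 L x
  rw [sub_self] at h
  rw [sub_self] at h
  exact h

/-- [folklore] The tree integral of a negative. -/
theorem treeGauge_neg (A : Form1 d R) (L : ℕ) (x : Site d) : treeGauge (-A) L x = -treeGauge A L x := by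
  have h := treeGauge_sub 0 A L x
  rwa [zero_sub, treeGauge_zero, zero_sub] at h

/-- [folklore] The tree integral of a sum. -/
theorem treeGauge_add (A A' : Form1 d R) (L : ℕ) (x : Site d) :
    treeGauge (A + A') L x = treeGauge A L x + treeGauge A' L x := by
  have h := treeGauge_sub A (-A') L x
  rwa [sub_neg_eq_add, treeGauge_neg, sub_neg_eq_add] at h

/-- [folklore] `Π 0 = 0`. -/
theorem axProj_zero (L : ℕ) : axProj L (0 : Form1 d R) = 0 := by
  funext κ x
  rw [axProj_apply, treeGauge_zero, treeGauge_zero, sub_zero, sub_zero, Pi.zero_apply, Pi.zero_apply]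

/-- [folklore] `Π` is additive: differences. -/
theorem axProj_sub (L : ℕ) (A A' : Form1 d R) : axProj L (A - A') = axProj L A - axProj L A' := by
  funext κ x
  simp only [axProj_apply, treeGauge_sub, Pi.sub_apply]
  abel

/-- [folklore] `Π` is additive: negation. -/
theorem axProj_neg (L : ℕ) (A : Form1 d R) : axProj L (-A) = -axProj L A := by
  funext κ x
  simp only [axProj_apply, treeGauge_neg, Pi.neg_apply]
  abel

/-- [folklore] `Π` is additive: sums. -/
theorem axProj_add (L : ℕ) (A A' : Form1 d R) : axProj L (A + A') = axProj L A + axProj L A' := by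
  funext κ x
  simp only [axProj_apply, treeGauge_add, Pi.add_apply]
  abel

end Linear

section Smul

variable {d : ℕ} {R : Type*} [CommRing R]

/-- [folklore] Over a commutative ring the tree integral is `R`-linear. -/
theorem treeGauge_smul (r : R) (A : Form1 d R) (L : ℕ) (x : Site d) :
    treeGauge (r • A) L x = r * treeGauge A L x := by
  have h := treeGauge_map (AddMonoidHom.mulLeft r) A L x
  simp only [AddMonoidHom.coe_mulLeft] at h
  rw [← h]
  rfl

/-- [folklore] Over a commutative ring `Π` is `R`-linear. -/
theorem axProj_smul (L : ℕ) (r : R) (A : Form1 d R) : axProj L (r • A) = r • axProj L A := by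
  funext κ x
  rw [Pi.smul_apply, Pi.smul_apply, smul_eq_mul, axProj_apply, axProj_apply, treeGauge_smul, treeGauge_smul]
  simp only [Pi.smul_apply, smul_eq_mul]
  ring

/-- [folklore] Over a commutative ring `grad = AffineAveraging.dz` inside `Π`: `Π A = A − dz (treeGauge A L)`. -/
theorem axProj_eq_sub_dz (L : ℕ) (A : Form1 d R) : axProj L A = A - dz (treeGauge A L) := rfl

end Smul

/-! ## §4 Coarse-translation covariance -/

section Shift

variable {d : ℕ} {R : Type*} [AddCommGroup R]

/-- [folklore] Block index under a coarse translation: `blk (x + L•v) = blk x + v` (`1 ≤ L`). -/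
theorem blk_add_zsmul {L : ℕ} (hL : 1 ≤ L) (x v : Site d) : blk L (x + (L : ℤ) • v) = blk L x + v := by
  have hL0 : (L : ℤ) ≠ 0 := by omega
  funext i
  simp only [blk, Pi.add_apply, Pi.smul_apply, smul_eq_mul]
  rw [Int.add_mul_ediv_left _ _ hL0]

/-- [folklore] The tree integral is coarse-translation covariant: `G(A)(x + L•v) = G(shift (L•v) A)(x)`. -/
theorem treeGauge_shift {L : ℕ} (hL : 1 ≤ L) (A : Form1 d R) (x v : Site d) :
    treeGauge A L (x + (L : ℤ) • v) = treeGauge (shift ((L : ℤ) • v) A) L x := by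
  rw [treeGauge, treeGauge, blk_add_zsmul hL, smul_add, ← axial_add]

/-- [folklore] **`Π` COMMUTES WITH COARSE TRANSLATIONS:** `Π (shift (L•v) A) = shift (L•v) (Π A)`. -/
theorem axProj_shift {L : ℕ} (hL : 1 ≤ L) (A : Form1 d R) (v : Site d) :
    axProj L (shift ((L : ℤ) • v) A) = shift ((L : ℤ) • v) (axProj L A) := by
  funext κ x
  show axProj L (shift ((L : ℤ) • v) A) κ x = axProj L A κ (x + (L : ℤ) • v)
  rw [axProj_apply, axProj_apply, add_right_comm x ((L : ℤ) • v) (unitVec κ), treeGauge_shift hL A x v,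
    treeGauge_shift hL A (x + unitVec κ) v]
  rfl

end Shift

/-! ## §5 Locality: `Π` is block-local (finite range) -/

section Local

variable {d : ℕ} {R : Type*} [AddCommGroup R]

omit [AddCommGroup R] in
/-- [folklore] Straight segments depend only on the letters they read. -/
theorem segUp_congr {A A' : Form1 d R} {z : Site d} {κ : Fin d} :
    ∀ {n : ℕ}, (∀ s : ℕ, s < n → A κ (z + (s : ℤ) • unitVec κ) = A' κ (z + (s : ℤ) • unitVec κ)) →
      segUp A z κ n = segUp A' z κ n
  | 0, _ => rfl
  | n + 1, h => by
    rw [segUp_succ, segUp_succ, segUp_congr (n := n) (fun s hs => h s (Nat.lt_succ_of_lt hs)), h n (Nat.lt_succ_self n)]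

/-- [folklore] In a block, every coordinate dominates the base coordinate: `L·blk x ≤ x` coordinatewise (`1 ≤ L`). -/
theorem zsmul_blk_le {L : ℕ} (hL : 1 ≤ L) (x : Site d) (i : Fin d) : ((L : ℤ) • blk L x) i ≤ x i := by
  have hL0 : (L : ℤ) ≠ 0 := by omega
  simp only [Pi.smul_apply, blk, smul_eq_mul]
  have h1 := Int.emod_nonneg (x i) hL0
  have e := Int.mul_ediv_add_emod (x i) (L : ℤ)
  linarith

/-- [folklore] … and is dominated by the base coordinate plus `L`: `x < L·blk x + L` coordinatewise (`1 ≤ L`). -/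
theorem lt_zsmul_blk_add {L : ℕ} (hL : 1 ≤ L) (x : Site d) (i : Fin d) : x i < ((L : ℤ) • blk L x) i + L := by
  have hL0 : (0 : ℤ) < L := by exact_mod_cast hL
  simp only [Pi.smul_apply, blk, smul_eq_mul]
  have h2 := Int.emod_lt_of_pos (x i) hL0
  have e := Int.mul_ediv_add_emod (x i) (L : ℤ)
  linarith

/-- [folklore] A point whose coordinates lie in the half-open block of `x` has the same block index (`1 ≤ L`). -/
theorem blk_eq_of_mem_block {L : ℕ} (hL : 1 ≤ L) {x z : Site d}
    (h1 : ∀ i, ((L : ℤ) • blk L x) i ≤ z i) (h2 : ∀ i, z i < ((L : ℤ) • blk L x) i + L) : blk L z = blk L x := by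
  have hL0 : (L : ℤ) ≠ 0 := by omega
  funext i
  have a := h1 i
  have b := h2 i
  simp only [Pi.smul_apply, smul_eq_mul, blk] at a b ⊢
  have hz : z i = (z i - (L : ℤ) * (x i / (L : ℤ))) + (L : ℤ) * (x i / (L : ℤ)) := by ring
  rw [hz, Int.add_mul_ediv_left _ _ hL0, Int.ediv_eq_zero_of_lt (by linarith) (by linarith), zero_add]

/-- [folklore] The points visited by the segment of `Γ_{base(x),x}` moving coordinate `m` lie in the block of `x`. -/
theorem blk_corner_add {L : ℕ} (hL : 1 ≤ L) (x : Site d) {m : ℕ} (hm : m < d) {s : ℕ}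
    (hs : (s : ℤ) < x ⟨m, hm⟩ - ((L : ℤ) • blk L x) ⟨m, hm⟩) :
    blk L (corner ((L : ℤ) • blk L x) x (m + 1) + (s : ℤ) • unitVec ⟨m, hm⟩) = blk L x := by
  have hL0 : (0 : ℤ) < L := by exact_mod_cast hL
  have hs0 : (0 : ℤ) ≤ s := by positivity
  have lo := zsmul_blk_le hL x
  have up := lt_zsmul_blk_add hL x
  simp only [Pi.smul_apply, smul_eq_mul] at lo up hs
  refine blk_eq_of_mem_block hL (fun i => ?_) (fun i => ?_)
  · simp only [Pi.add_apply, corner, Pi.smul_apply, smul_eq_mul, unitVec_apply]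
    by_cases hi : i = ⟨m, hm⟩
    · subst hi
      simp only [if_true, mul_one, show ¬ (m + 1 ≤ m) from by omega, if_false]
      linarith [lo ⟨m, hm⟩]
    · simp only [hi, if_false, mul_zero, add_zero]
      split
      · exact lo i
      · exact le_rfl
  · simp only [Pi.add_apply, corner, Pi.smul_apply, smul_eq_mul, unitVec_apply]
    by_cases hi : i = ⟨m, hm⟩
    · subst hi
      simp only [if_true, mul_one, show ¬ (m + 1 ≤ m) from by omega, if_false]
      linarith [up ⟨m, hm⟩]
    · simp only [hi, if_false, mul_zero, add_zero]
      split
      · exact up i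
      · linarith

/-- [folklore] The partial axial contours from the base point depend only on the letters of the block of `x`. -/
theorem axialAux_congr_block {L : ℕ} (hL : 1 ≤ L) {A A' : Form1 d R} {x : Site d}
    (h : ∀ (κ : Fin d) (z : Site d), blk L z = blk L x → A κ z = A' κ z) :
    ∀ m, axialAux A ((L : ℤ) • blk L x) x m = axialAux A' ((L : ℤ) • blk L x) x m
  | 0 => rfl
  | m + 1 => by
    by_cases hm : m < d
    · simp only [axialAux, dif_pos hm, axialAux_congr_block hL h m]
      congr 1
      have lo := zsmul_blk_le hL x ⟨m, hm⟩
      have hn : 0 ≤ x ⟨m, hm⟩ - ((L : ℤ) • blk L x) ⟨m, hm⟩ := by linarith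
      simp only [seg, hn, if_true]
      refine segUp_congr fun s hs => h ⟨m, hm⟩ _ (blk_corner_add hL x hm (s := s) ?_)
      have e : (((x ⟨m, hm⟩ - ((L : ℤ) • blk L x) ⟨m, hm⟩).toNat : ℕ) : ℤ) = x ⟨m, hm⟩ - ((L : ℤ) • blk L x) ⟨m, hm⟩ :=
        Int.toNat_of_nonneg hn
      have hs' : (s : ℤ) < (((x ⟨m, hm⟩ - ((L : ℤ) • blk L x) ⟨m, hm⟩).toNat : ℕ) : ℤ) := by exact_mod_cast hs
      linarith
    · simp only [axialAux, dif_neg hm, axialAux_congr_block hL h m]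

/-- [folklore] **LOCALITY OF THE TREE INTEGRAL:** `treeGauge A L x` depends on `A` only through the bonds read in the block of `x`. -/
theorem treeGauge_congr {L : ℕ} (hL : 1 ≤ L) {A A' : Form1 d R} {x : Site d}
    (h : ∀ (κ : Fin d) (z : Site d), blk L z = blk L x → A κ z = A' κ z) : treeGauge A L x = treeGauge A' L x := by
  rw [treeGauge, treeGauge, axial, axial, axialAux_congr_block hL h d]

/-- [folklore] **LOCALITY OF `Π` (FINITE RANGE, ONE BLOCK):** `Π A κ x` depends on `A` only through the bonds of the blocks of `x` and
of `x + e_κ` — fields agreeing there have the same dressing at `(κ, x)`. -/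
theorem axProj_congr_local {L : ℕ} (hL : 1 ≤ L) {A A' : Form1 d R} {κ : Fin d} {x : Site d}
    (h : ∀ (ν : Fin d) (z : Site d), blk L z = blk L x ∨ blk L z = blk L (x + unitVec κ) → A ν z = A' ν z) :
    axProj L A κ x = axProj L A' κ x := by
  have hx : blk L x = blk L x ∨ blk L x = blk L (x + unitVec κ) := Or.inl rfl
  rw [axProj_apply, axProj_apply, h κ x hx,
    treeGauge_congr hL (A := A) (A' := A') (x := x) fun ν z hz => h ν z (Or.inl hz),
    treeGauge_congr hL (A := A) (A' := A') (x := x + unitVec κ) fun ν z hz => h ν z (Or.inr hz)]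

/-- [folklore] In particular `Π` of a field vanishing on the two blocks vanishes at `(κ, x)`. -/
theorem axProj_eq_zero_of_local {L : ℕ} (hL : 1 ≤ L) {A : Form1 d R} {κ : Fin d} {x : Site d}
    (h : ∀ (ν : Fin d) (z : Site d), blk L z = blk L x ∨ blk L z = blk L (x + unitVec κ) → A ν z = 0) :
    axProj L A κ x = 0 := by
  rw [axProj_congr_local hL (A' := 0) (fun ν z hz => by rw [h ν z hz]; rfl), axProj_zero]
  rfl

end Local

/-! ## §6 The `U = 1` dictionary: Bałaban's linear average = the straight-contour average of the dressed field -/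

section Dictionary

variable {d : ℕ} {R : Type*} [AddCommGroup R]

/-- [folklore] **BAŁABAN'S LINEAR AVERAGE IS BLIND TO THE TREE DRESSING:** `linAvg (Π A) = linAvg A` — by (1.9) (`linAvg_gauge`) the
change is the coarse gradient of the gauge function `treeGauge A L` at base points, which vanishes (`treeGauge_base`). -/
theorem linAvg_axProj {L : ℕ} (hL : 1 ≤ L) (A : Form1 d R) (μ : Fin d) (y : Site d) :
    linAvg (axProj L A) L μ y = linAvg A L μ y := by
  rw [axProj, linAvg_gauge, ← smul_add, treeGauge_base hL, treeGauge_base hL, sub_zero, smul_zero, sub_zero]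

/-- [folklore] On the dressed field Bałaban's two points of view coincide: `linAvg (Π A) = straightSum (Π A)`. -/
theorem linAvg_axProj_eq_straightSum (L : ℕ) (A : Form1 d R) (μ : Fin d) (y : Site d) :
    linAvg (axProj L A) L μ y = straightSum (axProj L A) L μ y :=
  linAvg_eq_straightSum_of_axialGauge (axialGauge_axProj L A) μ y

end Dictionary

section DictionaryRing

variable {d : ℕ} {R : Type*} [CommRing R]

/-- [folklore] **«Q_Bal = Q_typed ∘ Π_ax» AT `U = 1`:** for EVERY fine field `A`, Bałaban's centre-to-centre linear average
([Balaban1985Averaging] (14), unnormalised: an1's `linAvg`) equals an2's straight-contour average `AffineAveraging.contourSum` (the base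
row of the typed KKT system) OF THE Π-DRESSED FIELD. -/
theorem linAvg_eq_contourSum_axProj {L : ℕ} (hL : 1 ≤ L) (A : Form1 d R) (μ : Fin d) (y : Site d) :
    linAvg A L μ y = contourSum L (axProj L A) μ y := by
  rw [← linAvg_axProj hL A μ y, linAvg_eq_contourSum_of_axialGauge (axialGauge_axProj L A)]

/-- [folklore] Equivalently: the two averagings differ, on every field, by the straight average of the residual pure gauge
`dz (treeGauge A L)` that `Π` removes. -/
theorem linAvg_eq_contourSum_sub {L : ℕ} (hL : 1 ≤ L) (A : Form1 d R) (μ : Fin d) (y : Site d) :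
    linAvg A L μ y = contourSum L A μ y - contourSum L (dz (treeGauge A L)) μ y := by
  rw [linAvg_eq_contourSum_axProj hL, axProj_eq_sub_dz]
  simp only [contourSum, Pi.sub_apply, Finset.sum_sub_distrib]

end DictionaryRing

/-! ## §8 The tree integral as a comb sum (the letters of `Γ_{y(x),x}` as a finite sum over bonds) -/

section Comb

variable {d : ℕ} {R : Type*} [AddCommGroup R]

omit [AddCommGroup R] in
/-- [folklore] The comb offset: the bond of `Γ_{y(p),p}` moving coordinate `α` at height `s` sits at the point with
offsets `off p` above `α`, `s` at `α`, `0` below `α`. -/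
def combVec (L : ℕ) (α : Fin d) (p : Site d) (s : ℕ) : Fin d → ℕ :=
  fun j => if α < j then off L p j else if j = α then s else 0

/-- [folklore] Straight-segment sums as `Finset` sums (additive-group version of an1's `segUp_sum`). -/
theorem segUp_sum' (A : Form1 d R) (z : Site d) (κ : Fin d) :
    ∀ n : ℕ, (segUp A z κ n).sum = ∑ s ∈ Finset.range n, A κ (z + (s : ℤ) • unitVec κ)
  | 0 => by rw [Finset.sum_range_zero]; rfl
  | n + 1 => by rw [segUp_succ, List.sum_append, List.sum_singleton, segUp_sum' A z κ n, Finset.sum_range_succ]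

omit [AddCommGroup R] in
/-- [folklore] The in-block height above the base point is the offset: `p_i − (L·blk p)_i = off p i` (`1 ≤ L`). -/
theorem sub_base_eq_off {L : ℕ} (hL : 1 ≤ L) (p : Site d) (i : Fin d) :
    p i - ((L : ℤ) • blk L p) i = ((off L p i : ℕ) : ℤ) := by
  have hL0 : (L : ℤ) ≠ 0 := by omega
  simp only [Pi.smul_apply, smul_eq_mul, blk, off]
  rw [Int.toNat_of_nonneg (Int.emod_nonneg _ hL0)]
  linarith [Int.mul_ediv_add_emod (p i) (L : ℤ)]

omit [AddCommGroup R] in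
/-- [folklore] Offsets are `< L` (`1 ≤ L`). -/
theorem off_lt {L : ℕ} (hL : 1 ≤ L) (p : Site d) (i : Fin d) : off L p i < L := by
  have h := off_mem_box hL p
  simp only [AffineAveraging.box, Fintype.mem_piFinset, Finset.mem_range] at h
  exact h i

/-- [folklore] The partial axial contours from the base point, summed: one straight in-block segment per coordinate
`i < m`, of `off p i` bonds, starting at the corner `corner y p (i+1)`. -/
theorem axialAux_base_sum {L : ℕ} (hL : 1 ≤ L) (A : Form1 d R) (p : Site d) :
    ∀ m, (axialAux A ((L : ℤ) • blk L p) p m).sum =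
      ∑ i ∈ Finset.range m, (if h : i < d then
        ∑ s ∈ Finset.range (off L p ⟨i, h⟩),
          A ⟨i, h⟩ (corner ((L : ℤ) • blk L p) p (i + 1) + (s : ℤ) • unitVec ⟨i, h⟩) else 0)
  | 0 => by rw [Finset.sum_range_zero]; rfl
  | m + 1 => by
    rw [Finset.sum_range_succ, ← axialAux_base_sum hL A p m]
    by_cases h : m < d
    · rw [dif_pos h, axialAux, dif_pos h, List.sum_append, add_comm]
      congr 1
      rw [seg, sub_base_eq_off hL p ⟨m, h⟩, if_pos (Int.natCast_nonneg _), Int.toNat_natCast, segUp_sum']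
    · rw [dif_neg h, axialAux, dif_neg h, List.nil_append, add_zero]

/-- [folklore] **THE TREE INTEGRAL AS A COMB SUM:**
`(G_tree τ_tree A)(p) = Σ_α Σ_{s < off p α} A_α(corner(y,p,α+1) + s·e_α)`, `y = L·blk p` (`1 ≤ L`). -/
theorem treeGauge_eq_sum_comb {L : ℕ} (hL : 1 ≤ L) (A : Form1 d R) (p : Site d) :
    treeGauge A L p = ∑ α : Fin d, ∑ s ∈ Finset.range (off L p α),
      A α (corner ((L : ℤ) • blk L p) p (α + 1) + (s : ℤ) • unitVec α) := by
  rw [treeGauge, axial, axialAux_base_sum hL A p d, Finset.sum_range]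
  refine Finset.sum_congr rfl fun α _ => ?_
  rw [dif_pos α.isLt]

omit [AddCommGroup R] in
/-- [folklore] The comb offset names the bond: `y + combVec α p s = corner(y,p,α+1) + s·e_α` (`1 ≤ L`). -/
theorem base_add_combVec {L : ℕ} (hL : 1 ≤ L) (α : Fin d) (p : Site d) (s : ℕ) :
    (L : ℤ) • blk L p + toSite (combVec L α p s) = corner ((L : ℤ) • blk L p) p (α + 1) + (s : ℤ) • unitVec α := by
  funext j
  have e := congrFun (blk_add_off hL p) j
  simp only [Pi.add_apply, toSite] at e
  simp only [Pi.add_apply, toSite, combVec, corner, Pi.smul_apply, smul_eq_mul, unitVec_apply]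
  by_cases h1 : α < j
  · have h1' : (α : ℕ) + 1 ≤ (j : ℕ) := by exact_mod_cast h1
    have hne : j ≠ α := ne_of_gt h1
    simp only [h1, if_true, h1', hne, if_false, mul_zero, add_zero]
    exact e
  · by_cases h2 : j = α
    · subst h2
      simp only [lt_irrefl, if_false, if_true, show ¬ ((j : ℕ) + 1 ≤ (j : ℕ)) from by omega, mul_one]
    · have h3 : ¬ ((α : ℕ) + 1 ≤ (j : ℕ)) := by
        intro h'
        exact h1 (by exact_mod_cast h' : (α : ℕ) < (j : ℕ))
      simp only [h1, h2, if_false, h3, Nat.cast_zero, add_zero, mul_zero]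

omit [AddCommGroup R] in
/-- [folklore] Comb offsets below the height `off p α` lie in the box (`1 ≤ L`). -/
theorem combVec_mem_box {L : ℕ} (hL : 1 ≤ L) (α : Fin d) (p : Site d) {s : ℕ} (hs : s < off L p α) :
    combVec L α p s ∈ box d L := by
  simp only [AffineAveraging.box, Fintype.mem_piFinset, Finset.mem_range, combVec]
  intro j
  have h1 := off_lt hL p j
  have h2 := off_lt hL p α
  split
  · exact h1
  · split
    · omega
    · omega

omit [AddCommGroup R] in
/-- [folklore] Comb offsets are injective in the height. -/
theorem combVec_injective (L : ℕ) (α : Fin d) (p : Site d) : Function.Injective (combVec L α p) := by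
  intro s t h
  have e := congrFun h α
  simpa [combVec] using e

end Comb

/-! ## §9 The transpose `Πᵀ` on bond families (`coProj`): the dressing of covariant kernel legs

For a contravariant one-form (a fluctuation field, a column of `ℋ`, a leg of `Γ`) the slice change acts by `Π`;
for a COVARIANT bond family (a kernel LEG of a jet, the bond slot of a stencil contracted against `ℋ`) it acts by
the transpose `Πᵀ = 1 − τ_treeᵀ ∘ G_treeᵀ ∘ dᵀ`: `dᵀ` is the bond-to-point codifferential `cod`, `G_treeᵀ` sums a
point function over the tree BELOW a bond (`InPath`), `τ_treeᵀ` extends by zero off the tree.  This is the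
operation by which the jets of a `JetData` are DRESSED (route (α): `TbalOf Lc (dress J)` keeps the weak-Landau
resolvent `KInv` and carries the slice change on the jets, by `tr(Π K Πᵀ · W) = tr(K · ΠᵀWΠ)`); its defining
property is the adjunction of §11. -/

section Transpose

variable {d : ℕ} {R : Type*} [AddCommGroup R]

/-- [folklore] The bond-to-point codifferential `(dᵀ g)(p) = Σ_κ (g_κ(p − e_κ) − g_κ(p))` (the transpose of `grad`
on finitely supported families). -/
def cod (g : Form1 d R) (p : Site d) : R := ∑ κ : Fin d, (g κ (p - unitVec κ) - g κ p)

omit [AddCommGroup R] in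
/-- [folklore] `InPath L α q p`: the bond `(α, q)` lies on the axial contour `Γ_{y(p),p}` from the base point of the
block of `p` — same block, coordinates above `α` already at `p`, coordinates below `α` still at the base, and the
`α`-coordinate strictly below `p_α`. -/
def InPath (L : ℕ) (α : Fin d) (q p : Site d) : Prop :=
  blk L p = blk L q ∧ (∀ j : Fin d, α < j → q j = p j) ∧ (∀ j : Fin d, j < α → q j = ((L : ℤ) • blk L q) j) ∧
    q α < p α

omit [AddCommGroup R] in
/-- [folklore] Path membership is decidable. -/
instance InPath.instDecidable (L : ℕ) (α : Fin d) (q p : Site d) : Decidable (InPath L α q p) := by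
  unfold InPath; infer_instance

/-- [folklore] The subtree sum `(G_treeᵀ h)(α, q) = Σ_{p ∈ block(q), (α,q) ∈ Γ_{y,p}} h(p)`, as a sum over the box of
offsets of the block of `q`. -/
def subtreeSum (L : ℕ) (h : Form0 d R) (α : Fin d) (q : Site d) : R :=
  ∑ c ∈ box d L, if InPath L α q ((L : ℤ) • blk L q + toSite c) then h ((L : ℤ) • blk L q + toSite c) else 0

/-- [folklore] **THE TRANSPOSE PROJECTOR** `Πᵀ g := g − G_treeᵀ (dᵀ g)` restricted to tree bonds (the `InPath`
indicator vanishes off the tree): the dressing of a covariant bond family. -/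
def coProj (L : ℕ) (g : Form1 d R) : Form1 d R := fun α q => g α q - subtreeSum L (cod g) α q

/-- [folklore] Pointwise form of `Πᵀ`. -/
theorem coProj_apply (L : ℕ) (g : Form1 d R) (α : Fin d) (q : Site d) :
    coProj L g α q = g α q - subtreeSum L (cod g) α q := rfl

/-- [folklore] `Πᵀ` of `0`. -/
theorem coProj_zero (L : ℕ) : coProj L (0 : Form1 d R) = 0 := by
  funext α q
  simp [coProj, subtreeSum, cod]

/-- [folklore] `dᵀ` is additive. -/
theorem cod_add (g g' : Form1 d R) (p : Site d) : cod (g + g') p = cod g p + cod g' p := by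
  simp only [cod, Pi.add_apply, ← Finset.sum_add_distrib]
  refine Finset.sum_congr rfl fun κ _ => ?_
  abel

/-- [folklore] `dᵀ` of a difference. -/
theorem cod_sub (g g' : Form1 d R) (p : Site d) : cod (g - g') p = cod g p - cod g' p := by
  simp only [cod, Pi.sub_apply, ← Finset.sum_sub_distrib]
  refine Finset.sum_congr rfl fun κ _ => ?_
  abel

/-- [folklore] The subtree sum is additive in the point function. -/
theorem subtreeSum_add (L : ℕ) (h h' : Form0 d R) (α : Fin d) (q : Site d) :
    subtreeSum L (h + h') α q = subtreeSum L h α q + subtreeSum L h' α q := by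
  simp only [subtreeSum, ← Finset.sum_add_distrib]
  refine Finset.sum_congr rfl fun c _ => ?_
  split
  · rfl
  · simp

/-- [folklore] The subtree sum of a difference. -/
theorem subtreeSum_sub (L : ℕ) (h h' : Form0 d R) (α : Fin d) (q : Site d) :
    subtreeSum L (h - h') α q = subtreeSum L h α q - subtreeSum L h' α q := by
  simp only [subtreeSum, ← Finset.sum_sub_distrib]
  refine Finset.sum_congr rfl fun c _ => ?_
  split
  · rfl
  · simp

/-- [folklore] `Πᵀ` IS ADDITIVE. -/
theorem coProj_add (L : ℕ) (g g' : Form1 d R) : coProj L (g + g') = coProj L g + coProj L g' := by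
  funext α q
  simp only [coProj, Pi.add_apply]
  rw [show cod (g + g') = cod g + cod g' from funext (cod_add g g'), subtreeSum_add]
  abel

/-- [folklore] `Πᵀ` of a difference. -/
theorem coProj_sub (L : ℕ) (g g' : Form1 d R) : coProj L (g - g') = coProj L g - coProj L g' := by
  funext α q
  simp only [coProj, Pi.sub_apply]
  rw [show cod (g - g') = cod g - cod g' from funext (cod_sub g g'), subtreeSum_sub]
  abel

omit [AddCommGroup R] in
/-- [folklore] A bond on a path lies in the block of the endpoint. -/
theorem InPath.blk_eq {L : ℕ} {α : Fin d} {q p : Site d} (h : InPath L α q p) : blk L p = blk L q := h.1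

/-- [folklore] **LOCALITY OF `Πᵀ`:** `(Πᵀ g)(α, q)` depends on `g` only through the bonds `(κ, z)` with `z` in the
block of `q` or `z + e_κ` in the block of `q` (the block and its incoming boundary bonds). -/
theorem coProj_congr_local (L : ℕ) {g g' : Form1 d R} {α : Fin d} {q : Site d}
    (h : ∀ (κ : Fin d) (z : Site d), (blk L z = blk L q ∨ blk L (z + unitVec κ) = blk L q) → g κ z = g' κ z) :
    coProj L g α q = coProj L g' α q := by
  simp only [coProj]
  rw [h α q (Or.inl rfl)]
  congr 1
  refine Finset.sum_congr rfl fun c _ => ?_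
  by_cases hP : InPath L α q ((L : ℤ) • blk L q + toSite c)
  · simp only [hP, if_true, cod]
    refine Finset.sum_congr rfl fun κ _ => ?_
    have hb : blk L ((L : ℤ) • blk L q + toSite c) = blk L q := hP.blk_eq
    rw [h κ _ (Or.inr (by rw [sub_add_cancel]; exact hb)), h κ _ (Or.inl hb)]
  · simp only [hP, if_false]

/-- [folklore] `Πᵀ` of a family vanishing on a block and its incoming boundary bonds vanishes at the bonds of that
block. -/
theorem coProj_eq_zero_of_local (L : ℕ) {g : Form1 d R} {α : Fin d} {q : Site d}
    (h : ∀ (κ : Fin d) (z : Site d), (blk L z = blk L q ∨ blk L (z + unitVec κ) = blk L q) → g κ z = 0) :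
    coProj L g α q = 0 := by
  rw [coProj_congr_local L (g' := 0) (fun κ z hz => by rw [h κ z hz]; rfl), coProj_zero]
  rfl

end Transpose

/-! ## §10 The tree integral as a path-indicator sum (the matrix of `G_tree ∘ τ_tree`) -/

section PathSum

variable {d : ℕ} {R : Type*} [AddCommGroup R]

omit [AddCommGroup R] in
/-- [folklore] **PATH MEMBERSHIP = COMB PARAMETRISATION:** an in-block point `y + c` is a bond of `Γ_{y,p}` moving
`α` iff `c` is a comb offset of height `< off p α` (`1 ≤ L`). -/
theorem inPath_iff {L : ℕ} (hL : 1 ≤ L) (α : Fin d) (p : Site d) {c : Fin d → ℕ} (hc : c ∈ box d L) :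
    InPath L α ((L : ℤ) • blk L p + toSite c) p ↔ ∃ s, s < off L p α ∧ c = combVec L α p s := by
  have hb : blk L ((L : ℤ) • blk L p + toSite c) = blk L p := blk_block _ hc
  have e : ∀ j, ((L : ℤ) • blk L p) j + ((off L p j : ℕ) : ℤ) = p j := fun j => by
    have := congrFun (blk_add_off hL p) j
    simpa only [Pi.add_apply, toSite] using this
  constructor
  · rintro ⟨-, h2, h3, h4⟩
    refine ⟨c α, ?_, ?_⟩
    · have h4' := h4
      simp only [Pi.add_apply, toSite] at h4'
      have := e α
      omega
    · funext j
      simp only [combVec]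
      by_cases h1 : α < j
      · simp only [h1, if_true]
        have := h2 j h1
        simp only [Pi.add_apply, toSite] at this
        have := e j
        omega
      · simp only [h1, if_false]
        by_cases hj : j = α
        · simp [hj]
        · simp only [hj, if_false]
          have hlt : j < α := lt_of_le_of_ne (not_lt.mp h1) hj
          have := h3 j hlt
          rw [hb] at this
          simp only [Pi.add_apply, toSite] at this
          omega
  · rintro ⟨s, hs, rfl⟩
    refine ⟨hb.symm, fun j hj => ?_, fun j hj => ?_, ?_⟩
    · simp only [Pi.add_apply, toSite, combVec, hj, if_true]
      exact e j
    · have h1 : ¬ α < j := not_lt.mpr hj.le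
      have h2 : j ≠ α := ne_of_lt hj
      rw [hb]
      simp only [Pi.add_apply, toSite, combVec, h1, h2, if_false, Nat.cast_zero, add_zero]
    · simp only [Pi.add_apply, toSite, combVec, lt_irrefl, if_false, if_true]
      have := e α
      omega

/-- [folklore] The path-indicator sum over the block equals the comb segment sum, per coordinate (`1 ≤ L`). -/
theorem sum_inPath_eq_sum_comb {L : ℕ} (hL : 1 ≤ L) (A : Form1 d R) (p : Site d) (α : Fin d) :
    (∑ c ∈ box d L, if InPath L α ((L : ℤ) • blk L p + toSite c) p then A α ((L : ℤ) • blk L p + toSite c) else 0)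
      = ∑ s ∈ Finset.range (off L p α), A α (corner ((L : ℤ) • blk L p) p (α + 1) + (s : ℤ) • unitVec α) := by
  classical
  rw [← Finset.sum_filter]
  have hset : (box d L).filter (fun c => InPath L α ((L : ℤ) • blk L p + toSite c) p)
      = (Finset.range (off L p α)).image (combVec L α p) := by
    ext c
    simp only [Finset.mem_filter, Finset.mem_image, Finset.mem_range]
    constructor
    · rintro ⟨hc, hP⟩
      obtain ⟨s, hs, rfl⟩ := (inPath_iff hL α p hc).mp hP
      exact ⟨s, hs, rfl⟩
    · rintro ⟨s, hs, rfl⟩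
      exact ⟨combVec_mem_box hL α p hs, (inPath_iff hL α p (combVec_mem_box hL α p hs)).mpr ⟨s, hs, rfl⟩⟩
  rw [hset, Finset.sum_image fun s _ t _ h => combVec_injective L α p h]
  refine Finset.sum_congr rfl fun s _ => ?_
  rw [base_add_combVec hL]

/-- [folklore] **THE MATRIX OF `G_tree ∘ τ_tree`:** the tree integral is the sum of `A` over the bonds of the block
weighted by the path indicator: `(G_tree τ_tree A)(p) = Σ_α Σ_{q ∈ block(p)} [ (α,q) ∈ Γ_{y,p} ] · A_α(q)`
(`1 ≤ L`). -/
theorem treeGauge_eq_sum_inPath {L : ℕ} (hL : 1 ≤ L) (A : Form1 d R) (p : Site d) :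
    treeGauge A L p = ∑ α : Fin d, ∑ c ∈ box d L,
      (if InPath L α ((L : ℤ) • blk L p + toSite c) p then A α ((L : ℤ) • blk L p + toSite c) else 0) := by
  rw [treeGauge_eq_sum_comb hL]
  exact Finset.sum_congr rfl fun α _ => (sum_inPath_eq_sum_comb hL A p α).symm

end PathSum

/-! ## §11 The adjunction `⟨Πᵀ g, A⟩ = ⟨g, Π A⟩` (finite support) — the defining property of the dressing -/

section Adjoint

variable {d : ℕ} {R : Type*} [CommRing R]

omit [CommRing R] in
/-- [folklore] A finite set of points is BLOCK-CLOSED if it is a union of whole `L`-blocks. -/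
def BlockClosed (L : ℕ) (U : Finset (Site d)) : Prop :=
  ∀ p ∈ U, ∀ c ∈ box d L, (L : ℤ) • blk L p + toSite c ∈ U

omit [CommRing R] in
/-- [folklore] Offsets embed injectively into the lattice. -/
theorem toSite_injective : Function.Injective (toSite (d := d)) := by
  intro b b' h
  funext i
  have e := congrFun h i
  simp only [toSite, Nat.cast_inj] at e
  exact e

omit [CommRing R] in
/-- [folklore] Inside a block-closed set, the block of a member is the image of the box of offsets (`1 ≤ L`). -/
theorem image_box_eq_filter {L : ℕ} (hL : 1 ≤ L) {U : Finset (Site d)} (hU : BlockClosed L U) {p : Site d}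
    (hp : p ∈ U) :
    (box d L).image (fun c => (L : ℤ) • blk L p + toSite c) = U.filter (fun q => blk L q = blk L p) := by
  ext q
  simp only [Finset.mem_image, Finset.mem_filter]
  constructor
  · rintro ⟨c, hc, rfl⟩
    exact ⟨hU p hp c hc, blk_block _ hc⟩
  · rintro ⟨-, hb⟩
    refine ⟨off L q, off_mem_box hL q, ?_⟩
    rw [← hb]
    exact blk_add_off hL q

/-- [folklore] **BLOCK DOUBLE-SUM SWAP:** over a block-closed set, summing `Φ(p, q)` over `p` and the points `q` of the
block of `p` equals summing over `q` and the points `p` of the block of `q` (`1 ≤ L`). -/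
theorem sum_block_swap {L : ℕ} (hL : 1 ≤ L) {U : Finset (Site d)} (hU : BlockClosed L U)
    (Φ : Site d → Site d → R) :
    ∑ p ∈ U, ∑ c ∈ box d L, Φ p ((L : ℤ) • blk L p + toSite c)
      = ∑ q ∈ U, ∑ c ∈ box d L, Φ ((L : ℤ) • blk L q + toSite c) q := by
  classical
  have hinj : ∀ p : Site d,
      Set.InjOn (fun c : Fin d → ℕ => (L : ℤ) • blk L p + toSite c) (box d L : Set (Fin d → ℕ)) :=
    fun p c _ c' _ h => toSite_injective (add_left_cancel h)
  have h1 : ∀ p ∈ U, ∑ c ∈ box d L, Φ p ((L : ℤ) • blk L p + toSite c)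
      = ∑ q ∈ U.filter (fun q => blk L q = blk L p), Φ p q := by
    intro p hp
    rw [← image_box_eq_filter hL hU hp, Finset.sum_image (hinj p)]
  have h2 : ∀ q ∈ U, ∑ c ∈ box d L, Φ ((L : ℤ) • blk L q + toSite c) q
      = ∑ p ∈ U.filter (fun p => blk L p = blk L q), Φ p q := by
    intro q hq
    rw [← image_box_eq_filter hL hU hq, Finset.sum_image (hinj q)]
  rw [Finset.sum_congr rfl h1, Finset.sum_congr rfl h2]
  refine Finset.sum_comm' fun p q => ?_
  simp only [Finset.mem_filter]
  constructor
  · rintro ⟨hp, hq, hb⟩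
    exact ⟨⟨hp, hb.symm⟩, hq⟩
  · rintro ⟨⟨hp, hb⟩, hq⟩
    exact ⟨hp, hq, hb.symm⟩

/-- [folklore] **SUMMATION BY PARTS** (`grad` against `cod`): for a bond family `g` whose support and heads lie in
`U`, `Σ_{x ∈ U} Σ_α g_α(x)·(T(x+e_α) − T(x)) = Σ_{p ∈ U} (dᵀ g)(p)·T(p)`. -/
theorem sum_mul_grad_eq {U : Finset (Site d)} (g : Form1 d R) (T : Form0 d R)
    (hg : ∀ (α : Fin d) (x : Site d), g α x ≠ 0 → x ∈ U ∧ x + unitVec α ∈ U) :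
    ∑ x ∈ U, ∑ α : Fin d, g α x * (T (x + unitVec α) - T x) = ∑ p ∈ U, cod g p * T p := by
  classical
  have hA : ∀ α : Fin d, ∑ x ∈ U, g α x * T (x + unitVec α) = ∑ p ∈ U, g α (p - unitVec α) * T p := by
    intro α
    have step1 : ∀ x ∈ U, g α x * T (x + unitVec α)
        = ∑ p ∈ U, (if x + unitVec α = p then g α x * T p else 0) := by
      intro x _
      rw [Finset.sum_ite_eq]
      by_cases hm : x + unitVec α ∈ U
      · rw [if_pos hm]
      · rw [if_neg hm]
        by_cases h0 : g α x = 0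
        · rw [h0, zero_mul]
        · exact absurd (hg α x h0).2 hm
    rw [Finset.sum_congr rfl step1, Finset.sum_comm]
    refine Finset.sum_congr rfl fun p _ => ?_
    have step2 : ∀ x ∈ U, (if x + unitVec α = p then g α x * T p else 0)
        = (if x = p - unitVec α then g α (p - unitVec α) * T p else 0) := by
      intro x _
      by_cases h : x + unitVec α = p
      · have h' : x = p - unitVec α := by rw [← h, add_sub_cancel_right]
        rw [if_pos h, if_pos h', ← h']
      · have h' : ¬ x = p - unitVec α := fun h' => h (by rw [h', sub_add_cancel])
        rw [if_neg h, if_neg h']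
    rw [Finset.sum_congr rfl step2, Finset.sum_ite_eq']
    by_cases hm : p - unitVec α ∈ U
    · rw [if_pos hm]
    · rw [if_neg hm]
      by_cases h0 : g α (p - unitVec α) = 0
      · rw [h0, zero_mul]
      · exact absurd (hg α _ h0).1 hm
  calc ∑ x ∈ U, ∑ α : Fin d, g α x * (T (x + unitVec α) - T x)
      = ∑ α : Fin d, (∑ x ∈ U, g α x * T (x + unitVec α) - ∑ x ∈ U, g α x * T x) := by
        rw [Finset.sum_comm]
        refine Finset.sum_congr rfl fun α _ => ?_
        rw [← Finset.sum_sub_distrib]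
        refine Finset.sum_congr rfl fun x _ => ?_
        ring
    _ = ∑ α : Fin d, ∑ p ∈ U, (g α (p - unitVec α) - g α p) * T p := by
        refine Finset.sum_congr rfl fun α _ => ?_
        rw [hA α, ← Finset.sum_sub_distrib]
        refine Finset.sum_congr rfl fun p _ => ?_
        ring
    _ = ∑ p ∈ U, cod g p * T p := by
        rw [Finset.sum_comm]
        refine Finset.sum_congr rfl fun p _ => ?_
        rw [cod, Finset.sum_mul]

/-- [folklore] **THE ADJUNCTION `⟨Πᵀ g, A⟩_U = ⟨g, Π A⟩_U`:** for a bond family `g` whose support and heads lie in a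
block-closed finite set `U` and ANY one-form `A`,
`Σ_{x ∈ U} Σ_α (Πᵀg)_α(x)·A_α(x) = Σ_{x ∈ U} Σ_α g_α(x)·(ΠA)_α(x)` (`1 ≤ L`).  This is the identity
`tr(K·Πᵀ W) = tr(Π K·W)` leg by leg: dressing the covariant jets by `Πᵀ` is the same as dressing the contravariant
resolvent / minimiser columns by `Π`. -/
theorem sum_coProj_mul {L : ℕ} (hL : 1 ≤ L) {U : Finset (Site d)} (hU : BlockClosed L U) (g A : Form1 d R)
    (hg : ∀ (α : Fin d) (x : Site d), g α x ≠ 0 → x ∈ U ∧ x + unitVec α ∈ U) :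
    ∑ x ∈ U, ∑ α : Fin d, coProj L g α x * A α x = ∑ x ∈ U, ∑ α : Fin d, g α x * axProj L A α x := by
  classical
  have eR : ∀ (x : Site d) (α : Fin d), g α x * axProj L A α x
      = g α x * A α x - g α x * (treeGauge A L (x + unitVec α) - treeGauge A L x) := by
    intro x α
    rw [axProj_apply]
    ring
  have eL : ∀ (x : Site d) (α : Fin d), coProj L g α x * A α x
      = g α x * A α x - subtreeSum L (cod g) α x * A α x := by
    intro x α
    rw [coProj_apply]
    ring
  simp only [eR, eL, Finset.sum_sub_distrib]
  congr 1
  rw [sum_mul_grad_eq g (treeGauge A L) hg]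
  symm
  calc ∑ p ∈ U, cod g p * treeGauge A L p
      = ∑ p ∈ U, ∑ α : Fin d, ∑ c ∈ box d L, (if InPath L α ((L : ℤ) • blk L p + toSite c) p then
          cod g p * A α ((L : ℤ) • blk L p + toSite c) else 0) := by
        refine Finset.sum_congr rfl fun p _ => ?_
        rw [treeGauge_eq_sum_inPath hL, Finset.mul_sum]
        refine Finset.sum_congr rfl fun α _ => ?_
        rw [Finset.mul_sum]
        refine Finset.sum_congr rfl fun c _ => ?_
        split
        · rfl
        · rw [mul_zero]
    _ = ∑ α : Fin d, ∑ p ∈ U, ∑ c ∈ box d L, (if InPath L α ((L : ℤ) • blk L p + toSite c) p then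
          cod g p * A α ((L : ℤ) • blk L p + toSite c) else 0) := Finset.sum_comm
    _ = ∑ α : Fin d, ∑ q ∈ U, ∑ c ∈ box d L, (if InPath L α q ((L : ℤ) • blk L q + toSite c) then
          cod g ((L : ℤ) • blk L q + toSite c) * A α q else 0) := by
        refine Finset.sum_congr rfl fun α _ => ?_
        exact sum_block_swap hL hU (fun p q => if InPath L α q p then cod g p * A α q else 0)
    _ = ∑ α : Fin d, ∑ q ∈ U, subtreeSum L (cod g) α q * A α q := by
        refine Finset.sum_congr rfl fun α _ => ?_
        refine Finset.sum_congr rfl fun q _ => ?_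
        rw [subtreeSum, Finset.sum_mul]
        refine Finset.sum_congr rfl fun c _ => ?_
        split
        · rfl
        · rw [zero_mul]
    _ = ∑ x ∈ U, ∑ α : Fin d, subtreeSum L (cod g) α x * A α x := Finset.sum_comm

end Adjoint

/-! ## §12 Sup bounds: `Π` and `Πᵀ` are bounded finite-range operators (real one-forms) -/

section Bounds

variable {d : ℕ}

/-- [folklore] **SUP BOUND FOR THE TREE INTEGRAL:** `|G_tree τ_tree A (p)| ≤ d·L·M` if `|A| ≤ M` on the bonds based
in the block of `p` (`1 ≤ L`; the contour has `< d·L` bonds, all in the block). -/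
theorem abs_treeGauge_le {L : ℕ} (hL : 1 ≤ L) (A : Form1 d ℝ) (p : Site d) {M : ℝ} (hM0 : 0 ≤ M)
    (hM : ∀ (α : Fin d) (q : Site d), blk L q = blk L p → |A α q| ≤ M) :
    |treeGauge A L p| ≤ d * L * M := by
  rw [treeGauge_eq_sum_comb hL]
  have inner : ∀ α : Fin d, |∑ s ∈ Finset.range (off L p α),
      A α (corner ((L : ℤ) • blk L p) p (α + 1) + (s : ℤ) • unitVec α)| ≤ (L : ℝ) * M := by
    intro α
    calc |∑ s ∈ Finset.range (off L p α), A α (corner ((L : ℤ) • blk L p) p (α + 1) + (s : ℤ) • unitVec α)|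
        ≤ ∑ s ∈ Finset.range (off L p α),
            |A α (corner ((L : ℤ) • blk L p) p (α + 1) + (s : ℤ) • unitVec α)| :=
          Finset.abs_sum_le_sum_abs _ _
      _ ≤ ∑ s ∈ Finset.range (off L p α), M :=
          Finset.sum_le_sum fun s hs => hM α _ (by
            rw [← base_add_combVec hL]
            exact blk_block _ (combVec_mem_box hL α p (Finset.mem_range.mp hs)))
      _ = (off L p α : ℝ) * M := by rw [Finset.sum_const, Finset.card_range, nsmul_eq_mul]
      _ ≤ (L : ℝ) * M := by
          have h := (off_lt hL p α).le
          exact mul_le_mul_of_nonneg_right (by exact_mod_cast h) hM0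
  calc |∑ α : Fin d, ∑ s ∈ Finset.range (off L p α),
          A α (corner ((L : ℤ) • blk L p) p (α + 1) + (s : ℤ) • unitVec α)|
      ≤ ∑ α : Fin d, |∑ s ∈ Finset.range (off L p α),
          A α (corner ((L : ℤ) • blk L p) p (α + 1) + (s : ℤ) • unitVec α)| := Finset.abs_sum_le_sum_abs _ _
    _ ≤ ∑ α : Fin d, (L : ℝ) * M := Finset.sum_le_sum fun α _ => inner α
    _ = d * L * M := by
        rw [Finset.sum_const, Finset.card_univ, Fintype.card_fin, nsmul_eq_mul]
        ring

/-- [folklore] **SUP BOUND FOR `Π`:** `|(ΠA)_α(x)| ≤ (1 + 2·d·L)·M` if `|A| ≤ M` on the bonds based in the blocks of `x`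
and of `x + e_α` (`1 ≤ L`) — `Π` is a bounded operator of range one block. -/
theorem abs_axProj_le {L : ℕ} (hL : 1 ≤ L) (A : Form1 d ℝ) (α : Fin d) (x : Site d) {M : ℝ} (hM0 : 0 ≤ M)
    (hM : ∀ (κ : Fin d) (q : Site d), (blk L q = blk L x ∨ blk L q = blk L (x + unitVec α)) → |A κ q| ≤ M) :
    |axProj L A α x| ≤ (1 + 2 * (d : ℝ) * L) * M := by
  rw [axProj_apply]
  have h0 : |A α x| ≤ M := hM α x (Or.inl rfl)
  have h1 := abs_treeGauge_le hL A (x + unitVec α) hM0 (fun κ q hq => hM κ q (Or.inr hq))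
  have h2 := abs_treeGauge_le hL A x hM0 (fun κ q hq => hM κ q (Or.inl hq))
  calc |A α x - (treeGauge A L (x + unitVec α) - treeGauge A L x)|
      ≤ |A α x| + (|treeGauge A L (x + unitVec α)| + |treeGauge A L x|) := by
        linarith [abs_sub (A α x) (treeGauge A L (x + unitVec α) - treeGauge A L x),
          abs_sub (treeGauge A L (x + unitVec α)) (treeGauge A L x)]
    _ ≤ M + (d * L * M + d * L * M) := by linarith
    _ = (1 + 2 * (d : ℝ) * L) * M := by ring

/-- [folklore] Sup bound for the codifferential: `|dᵀg (p)| ≤ 2·d·M`. -/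
theorem abs_cod_le (g : Form1 d ℝ) (p : Site d) {M : ℝ}
    (hM : ∀ κ : Fin d, |g κ (p - unitVec κ)| ≤ M ∧ |g κ p| ≤ M) : |cod g p| ≤ 2 * (d : ℝ) * M := by
  rw [cod]
  calc |∑ κ : Fin d, (g κ (p - unitVec κ) - g κ p)|
      ≤ ∑ κ : Fin d, |g κ (p - unitVec κ) - g κ p| := Finset.abs_sum_le_sum_abs _ _
    _ ≤ ∑ κ : Fin d, 2 * M :=
        Finset.sum_le_sum fun κ _ => (abs_sub _ _).trans (by linarith [(hM κ).1, (hM κ).2])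
    _ = 2 * (d : ℝ) * M := by
        rw [Finset.sum_const, Finset.card_univ, Fintype.card_fin, nsmul_eq_mul]
        ring

/-- [folklore] **SUP BOUND FOR `Πᵀ`:** `|(Πᵀg)_α(q)| ≤ (1 + 2·d·L^d)·M` if `|g| ≤ M` on the bonds of the block of `q`
and its incoming boundary bonds — `Πᵀ` is a bounded operator of range one block. -/
theorem abs_coProj_le (L : ℕ) (g : Form1 d ℝ) (α : Fin d) (q : Site d) {M : ℝ} (hM0 : 0 ≤ M)
    (hM : ∀ (κ : Fin d) (z : Site d), (blk L z = blk L q ∨ blk L (z + unitVec κ) = blk L q) → |g κ z| ≤ M) :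
    |coProj L g α q| ≤ (1 + 2 * (d : ℝ) * (L : ℝ) ^ d) * M := by
  rw [coProj_apply]
  have h0 : |g α q| ≤ M := hM α q (Or.inl rfl)
  have h1 : |subtreeSum L (cod g) α q| ≤ (L : ℝ) ^ d * (2 * (d : ℝ) * M) := by
    rw [subtreeSum]
    calc |∑ c ∈ box d L, (if InPath L α q ((L : ℤ) • blk L q + toSite c) then
            cod g ((L : ℤ) • blk L q + toSite c) else 0)|
        ≤ ∑ c ∈ box d L, |(if InPath L α q ((L : ℤ) • blk L q + toSite c) then
            cod g ((L : ℤ) • blk L q + toSite c) else 0)| := Finset.abs_sum_le_sum_abs _ _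
      _ ≤ ∑ c ∈ box d L, 2 * (d : ℝ) * M := Finset.sum_le_sum fun c hc => by
          have hb : blk L ((L : ℤ) • blk L q + toSite c) = blk L q := blk_block _ hc
          split
          · exact abs_cod_le g _ fun κ =>
              ⟨hM κ _ (Or.inr (by rw [sub_add_cancel]; exact hb)), hM κ _ (Or.inl hb)⟩
          · rw [abs_zero]
            positivity
      _ = (L : ℝ) ^ d * (2 * (d : ℝ) * M) := by
          -- `#box = L^d` (the count is `Literature.Algebra.EuclideanLattices.Regev2004.card_box`; computed inline here)
          have hcard : (box d L).card = L ^ d := by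
            rw [AffineAveraging.box, Fintype.card_piFinset]
            simp only [Finset.card_range, Finset.prod_const, Finset.card_univ, Fintype.card_fin]
          rw [Finset.sum_const, hcard, nsmul_eq_mul, Nat.cast_pow]
  calc |g α q - subtreeSum L (cod g) α q| ≤ |g α q| + |subtreeSum L (cod g) α q| := abs_sub _ _
    _ ≤ M + (L : ℝ) ^ d * (2 * (d : ℝ) * M) := add_le_add h0 h1
    _ = (1 + 2 * (d : ℝ) * (L : ℝ) ^ d) * M := by ring

end Bounds

/-! ## §7 Sanity instances on `ℤ²`, `L = 2` (the general theorems specialised; nothing new) -/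

section Examples

/-- [folklore] Sanity: the dressing of an1's labelled test field on `ℤ²` is axial (instance of §1). -/
example : AxialGauge (axProj 2 AveragingContours.label) 2 := axialGauge_axProj 2 _

/-- [folklore] Sanity: `Π` kills the gradient of a function vanishing at the `2ℤ²` base points (instance of §2). -/
example (f : Site 2 → ℤ) (hf : ∀ y : Site 2, f (((2 : ℕ) : ℤ) • y) = 0) : axProj 2 (grad f) = 0 :=
  axProj_grad_eq_zero 2 hf

/-- [folklore] Sanity: `Π` is idempotent at `L = 2` (instance of §1). -/
example (A : Form1 2 ℤ) : axProj 2 (axProj 2 A) = axProj 2 A := axProj_idem (by norm_num) A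

end Examples

end Literature.MathematicalPhysics.QuantumFieldTheory.Balaban1983to89.Beta.AxialProjector
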